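import Literature.Geometry.Kaehler.HolomorphicChainRectifiable
import Literature.Geometry.Kaehler.AnalyticSetHausdorffNull
import HarnessLib

/-!
# The singular locus of a holomorphic `p`-chain is `𝓗^{2p-1}`-null

Brick S1 of the proof of the named fact
`Literature.Geometry.Kaehler.Harvey1977_boundary_toCurrent_eq_zero` (`d[T] = 0`,
[Harvey1977, Lemma 1.8]): Harvey's "`𝓗^{2p-1}(Sing V ∩ K) = 0`, since the Hausdorff dimension of
`Sing V` is `≤ 2p - 2`" [Harvey1977, proof of Lemma 1.8, p. 320 (citing Lemma 1.6)].

* `IsAnalyticSet.hausdorffMeasure_image_eq_zero_of_lt` — the nullity theorem of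
  `AnalyticSetHausdorffNull.lean` for an ARBITRARY exponent: an analytic subset of `Ω ⊆ V` all of
  whose regular points have dimension `≤ d` is `𝓗ᵏ`-null for every natural `k > 2d` (same
  induction on `d` through the Cartan–Whitney theorem `sng Z` analytic and
  `IsAnalyticSet.succ_le_codim_singularLocus`; the tree's version is the case `k = 2p`);
* `HolomorphicChain.hausdorffMeasure_image_singularLocus_eq_zero`,
  `HolomorphicChain.euclideanHausdorffMeasure_image_singularLocus_eq_zero` — for a holomorphic
  `p`-chain `T`, the image in `V` of `sng |T|` is `𝓗ᵏ`-null for `k > 2(p-1)` (all regular points of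
  `|T|` have dimension `p`, `HolomorphicChain.codim_eq_of_mem_regularLocus`, so `sng |T|` has
  dimension `≤ p - 1`), in particular `μHE[2q+1]`-null for `p = q + 1`.

## References

* R. Harvey, *Holomorphic chains and their boundaries*, PSPUM XXX.1 (1977), Lemma 1.6, Lemma 1.8.
* E. M. Chirka, *Complex Analytic Sets*, Kluwer 1989, §3.7 Cor. (p. 39), §5.2 Thm. 2.
-/

open Complex Metric Set Filter Function MeasureTheory MeasureTheory.Measure
open scoped Topology Manifold ENNReal

namespace Literature.Geometry.Kaehler

section Null

variable {V : Type*} [NormedAddCommGroup V] [NormedSpace ℂ V] [FiniteDimensional ℂ V]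
  [MeasurableSpace V] [BorelSpace V] {Ω : TopologicalSpace.Opens V}

/-- **Analytic sets of dimension `≤ d` are `𝓗ᵏ`-null for `k > 2d`.** Let `Z` be an analytic
subset of the open set `Ω ⊆ V` all of whose regular points have codimension `c` with
`dim V ≤ c + d` ("`dim Z ≤ d`"). Then for every natural `k > 2d` the image of `Z` in `V` is
`μH[k]`-null. Induction on `d`: the regular part is `𝓗ᵏ`-null
(`hausdorffMeasure_image_regularLocus_eq_zero`); the singular locus is analytic (Cartan–Whitney,
`isAnalyticSet_singularLocus_holds`) with regular points of dimension `≤ d - 1`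
(`IsAnalyticSet.succ_le_codim_singularLocus`). [cite: Chirka1989, §3.7 Cor., p. 39] -/
theorem IsAnalyticSet.hausdorffMeasure_image_eq_zero_of_lt {d : ℕ} :
    ∀ {Z : Set Ω}, IsAnalyticSet 𝓘(ℂ, V) Z →
      (∀ y c, y ∈ Z → IsRegularPointOfCodim 𝓘(ℂ, V) Z c y → Module.finrank ℂ V ≤ c + d) →
      ∀ {k : ℕ}, 2 * d < k → μH[k] ((↑) '' Z : Set V) = 0 := by
  induction d with
  | zero =>
    intro Z hZ hcod k hk
    -- the singular locus is empty
    have hsing : singularLocus 𝓘(ℂ, V) Z = ∅ := by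
      have hS := isAnalyticSet_singularLocus_holds 𝓘(ℂ, V) Ω hZ
      refine hS.eq_empty_of_regularLocus_eq_empty (eq_empty_iff_forall_notMem.2 fun y hy => ?_)
      obtain ⟨hyS, c, hc⟩ := hy
      have h1 := hZ.succ_le_codim_singularLocus (c₀ := Module.finrank ℂ V)
        (fun z c hz h => by have := hcod z c hz h; omega) hyS hc
      have h2 := hc.le_finrank
      omega
    have hZeq : Z = regularLocus 𝓘(ℂ, V) Z := by
      conv_lhs => rw [← regularLocus_union_singularLocus (I := 𝓘(ℂ, V)) Z, hsing, union_empty]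
    rw [hZeq]
    exact hausdorffMeasure_image_regularLocus_eq_zero fun y c hy h => by
      have := hcod y c hy h; omega
  | succ d ih =>
    intro Z hZ hcod k hk
    have hS := isAnalyticSet_singularLocus_holds 𝓘(ℂ, V) Ω hZ
    have hreg : μH[k] ((↑) '' regularLocus 𝓘(ℂ, V) Z : Set V) = 0 :=
      hausdorffMeasure_image_regularLocus_eq_zero fun y c hy h => by
        have := hcod y c hy h; omega
    have hsing : μH[k] ((↑) '' singularLocus 𝓘(ℂ, V) Z : Set V) = 0 := by
      refine ih hS (fun y c hy h => ?_) (by omega)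
      have := hZ.succ_le_codim_singularLocus (c₀ := Module.finrank ℂ V - (d + 1))
        (fun z c hz h' => by have := hcod z c hz h'; omega) hy h
      omega
    rw [← regularLocus_union_singularLocus (I := 𝓘(ℂ, V)) Z, image_union]
    exact measure_union_null hreg hsing

end Null

/-! ### The singular locus of the support of a holomorphic chain -/

namespace HolomorphicChain

variable {V : Type*} [NormedAddCommGroup V] [InnerProductSpace ℂ V] [FiniteDimensional ℂ V]
  [MeasurableSpace V] [BorelSpace V] {Ω : TopologicalSpace.Opens V} {p : ℕ}

/-- **`𝓗ᵏ(sng |T|) = 0` for `k > 2(p - 1)`**: every regular point of the support `|T|` of a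
holomorphic `p`-chain has codimension `dim V - p` (`codim_eq_of_mem_regularLocus`), so by
`IsAnalyticSet.succ_le_codim_singularLocus` the analytic set `sng |T|` has dimension `≤ p - 1`, and
the nullity theorem applies. Harvey: "the Hausdorff dimension of `Sing V` is `≤ 2p - 2`".
[cite: Harvey1977, Lemma 1.6 and proof of Lemma 1.8] -/
theorem hausdorffMeasure_image_singularLocus_eq_zero (T : HolomorphicChain 𝓘(ℂ, V) Ω p) {k : ℕ}
    (hk : 2 * (p - 1) < k) :
    μH[k] ((↑) '' singularLocus 𝓘(ℂ, V) T.support : Set V) = 0 := by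
  haveI : LocallyCompactSpace Ω := Ω.isOpen.locallyCompactSpace
  set n := Module.finrank ℂ V with hn
  have hZ : IsAnalyticSet 𝓘(ℂ, V) T.support := T.isAnalyticSet_support
  have hS := isAnalyticSet_singularLocus_holds 𝓘(ℂ, V) Ω hZ
  -- every regular point of `|T|` has codimension `n - p` (and then `p ≤ n`)
  have hc₀ : ∀ z c, z ∈ T.support → IsRegularPointOfCodim 𝓘(ℂ, V) T.support c z → n - p ≤ c := by
    intro z c hz h
    have := T.codim_eq_of_mem_regularLocus ⟨hz, c, h⟩ h
    omega
  rcases Nat.eq_zero_or_pos p with hp | hp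
  · -- `p = 0`: the singular locus has no regular points, hence is empty
    subst hp
    have hSe : singularLocus 𝓘(ℂ, V) T.support = ∅ := by
      refine hS.eq_empty_of_regularLocus_eq_empty (eq_empty_iff_forall_notMem.2 fun y hy => ?_)
      obtain ⟨hyS, c, hc⟩ := hy
      have h1 := hZ.succ_le_codim_singularLocus hc₀ hyS hc
      have h2 := hc.le_finrank
      omega
    rw [hSe, image_empty, measure_empty]
  · refine hS.hausdorffMeasure_image_eq_zero_of_lt (d := p - 1) (fun y c hy h => ?_) (by omega)
    have h1 := hZ.succ_le_codim_singularLocus hc₀ hy h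
    have h2 := h.le_finrank
    omega

/-- **`𝓗^{2q+1}(sng |T|) = 0` for a holomorphic `(q+1)`-chain**, for the Euclidean-normalised
Hausdorff measure `μHE[2q+1]` of `Currents.lean`. [cite: Harvey1977, proof of Lemma 1.8] -/
theorem euclideanHausdorffMeasure_image_singularLocus_eq_zero {q : ℕ}
    (T : HolomorphicChain 𝓘(ℂ, V) Ω (q + 1)) :
    (μHE[2 * q + 1] : Measure V) ((↑) '' singularLocus 𝓘(ℂ, V) T.support : Set V) = 0 := by
  rw [euclideanHausdorffMeasure_def, Measure.smul_apply,
    T.hausdorffMeasure_image_singularLocus_eq_zero (k := 2 * q + 1) (by omega), smul_zero]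

end HolomorphicChain

end Literature.Geometry.Kaehler
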